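import Summits.AtomisticToContinuum.Crystallization.Theorems.HolmgrenBoyleLindHalfSpaceUniqueContinuationThickDefect
import Summits.AtomisticToContinuum.Crystallization.Theorems.HolmgrenBoyleLindCentrosymmetric

/-!
# Route `HolmgrenBoyleLind`: Lennard-Jones force fields of separated sources, part 8 —
recurrent columns; Bravais half-crystals
Support file for the crux item stmt-AtomisticToContinuum-6075 (`HalfSpaceUniqueContinuation`, line
`registered`: infrastructure for its open stubs, written by a stub-worker of lead c2), continuing
parts 6 and 7 (`hbl_eq_of_thick_normal_lines`, `hbl_thick_of_bounded_gaps`,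
`hbl_iff_of_thick_normal_line`):

* `hbl_eq_of_recurrent_columns` — two `δ`-separated sets in exact Lennard-Jones force balance
  agreeing on `{⟪z, u⟫ < a}` are EQUAL as soon as below every point `x ∈ ω ∪ ω'` the normal column
  `x − ℝ u` is RECURRENT in `ω`: beyond some `T₀` every window `[T, T + G]` of the column holds a
  point `x − τ u ∈ ω` (a defect lies in `ω ∪ ω'`; bounded gaps ⇒ thick, `hbl_thick_of_bounded_gaps`;
  thick below every defect ⇒ equal, `hbl_eq_of_thick_normal_lines`);
* `hbl_lattice_eq_of_registered_halfSpace` — Bravais half-crystal rigidity along a rational facet: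
  a `δ`-separated balanced `ω` that coincides with a full-rank lattice `L` on the open half-space
  `{⟪z, γ⟫ < a}`, `γ ∈ L ∖ {0}`, and is REGISTERED over `L` along `γ` (`ω ⊆ L + ℝ γ`) is `L` itself:
  the column `x − ℝ γ` of any `x = y + s γ`, `y ∈ L`, contains the progression `y − k γ ∈ L`,
  `k ∈ ℤ`, of step `‖γ‖`, which lies in `ω` below the plane — recurrent columns.
All `[folklore]`; nothing here closes an item.
-/

noncomputable section
namespace Summit.AtomisticToContinuum.Crystallization.Theorems.HolmgrenBoyleLind

open scoped BigOperators Topology InnerProductSpace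
open Literature.MathematicalPhysics.StatisticalMechanics
open Summit.AtomisticToContinuum.Crystallization.Theorems

/-- **Unique continuation from recurrent columns.** Let `ω, ω' ⊂ ℝ³` be `δ`-separated, both in
exact Lennard-Jones force balance, agreeing on the open half-space `{⟪z, u⟫ < a}` (`u` a unit
vector). Suppose that below every point `x ∈ ω ∪ ω'` the normal column `x − ℝ u` is recurrent in
`ω`: there are `T₀` and a gap bound `G ≥ 0` such that every window `τ ∈ [T, T + G]`, `T ≥ T₀`,
contains a point `x − τ u ∈ ω`. Then `ω = ω'`. Proof: a defect `x` (`¬ (x ∈ ω ↔ x ∈ ω')`) lies in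
`ω ∪ ω'`; its column re-based at `max T₀ (⟪x, u⟫ − a + 2)` still has gaps `≤ G`, hence is thick
(`hbl_thick_of_bounded_gaps`: injective `tₙ ≥ ⟪x, u⟫ − a + 2`, `Σ 1/tₙ = ∞`, `x − tₙ u ∈ ω`), and
`hbl_eq_of_thick_normal_lines` applies. No periodicity is used. [folklore] -/
theorem hbl_eq_of_recurrent_columns :
    ∀ (ω ω' : Set (EuclideanSpace ℝ (Fin 3))) (δ : ℝ), 0 < δ →
      (∀ a ∈ ω, ∀ b ∈ ω, a ≠ b → δ ≤ dist a b) →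
      (∀ a ∈ ω', ∀ b ∈ ω', a ≠ b → δ ≤ dist a b) →
      (∀ x ∈ ω, HasSum (fun y : {y : EuclideanSpace ℝ (Fin 3) // y ∈ ω ∧ y ≠ x} =>
        (deriv Literature.MathematicalPhysics.StatisticalMechanics.lennardJones (dist x y) / dist x y) •
          (x - (y : EuclideanSpace ℝ (Fin 3)))) 0) →
      (∀ x ∈ ω', HasSum (fun y : {y : EuclideanSpace ℝ (Fin 3) // y ∈ ω' ∧ y ≠ x} =>
        (deriv Literature.MathematicalPhysics.StatisticalMechanics.lennardJones (dist x y) / dist x y) •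
          (x - (y : EuclideanSpace ℝ (Fin 3)))) 0) →
      ∀ (u : EuclideanSpace ℝ (Fin 3)) (a : ℝ), ‖u‖ = 1 →
      (∀ z : EuclideanSpace ℝ (Fin 3), inner ℝ z u < a → (z ∈ ω ↔ z ∈ ω')) →
      (∀ x ∈ ω ∪ ω', ∃ T₀ G : ℝ, 0 ≤ G ∧ ∀ T : ℝ, T₀ ≤ T →
        ∃ τ : ℝ, T ≤ τ ∧ τ ≤ T + G ∧ x - τ • u ∈ ω) →
      ω = ω' := by
  intro ω ω' δ hδ hsep hsep' hbal hbal' u a hu hagree hrec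
  refine hbl_eq_of_thick_normal_lines _ _ _ hδ hsep hsep' hbal hbal' _ _ hu hagree fun x hx => ?_
  -- a defect lies in `ω ∪ ω'`
  have hxm : x ∈ ω ∪ ω' := by
    by_contra h
    rw [Set.mem_union, not_or] at h
    exact hx ⟨fun h' => (h.1 h').elim, fun h' => (h.2 h').elim⟩
  obtain ⟨T₀, G, hG, hrow⟩ := hrec x hxm
  -- re-base the recurrent column at `max T₀ (⟪x, u⟫ - a + 2)`: still gaps `≤ G`, hence thick
  obtain ⟨t, ht, hinj, hsum, htω⟩ :=
    hbl_thick_of_bounded_gaps (ω := ω) (x := x) (u := u) (T₀ := max T₀ (⟪x, u⟫_ℝ - a + 2)) hG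
      fun T hT => hrow T ((le_max_left _ _).trans hT)
  exact ⟨t, fun n => (le_max_right _ _).trans (ht n), hinj, hsum, htω⟩

/-- **Bravais half-crystal rigidity along a rational facet.** Let `L ⊆ ℝ³` be a full-rank lattice
and `γ ∈ L ∖ {0}`. Let `ω` be `δ`-separated, in exact Lennard-Jones force balance, equal to `L` on
the open half-space `{⟪z, γ⟫ < a}`, and registered over `L` along `γ`: every `x ∈ ω` is `y + s γ`
with `y ∈ L`, `s ∈ ℝ`. Then `ω = L`. Proof: `L` is `δ_L`-separated and balanced
(`hbl_lattice_hypotheses`); with `u = γ/‖γ‖` the two sets agree on `{⟪z, u⟫ < a/‖γ‖}`; the column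
`x − τ u` of `x = y + s γ ∈ ω ∪ L` passes, at `τ = (s + k)‖γ‖`, `k ∈ ℤ`, through `y − k γ ∈ L`,
which lies in `ω` once `⟪y − k γ, γ⟫ < a` — so beyond `T₀ = (⟪x, γ⟫ − a)/‖γ‖ + 1` every window of
length `‖γ‖` of the column holds a point of `ω`, and `hbl_eq_of_recurrent_columns` applies with
`min δ δ_L`. [folklore] -/
theorem hbl_lattice_eq_of_registered_halfSpace :
    ∀ (L : Submodule ℤ (EuclideanSpace ℝ (Fin 3))) [DiscreteTopology L] [IsZLattice ℝ L]
      (γ : EuclideanSpace ℝ (Fin 3)), γ ∈ L → γ ≠ 0 →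
    ∀ (ω : Set (EuclideanSpace ℝ (Fin 3))) (δ : ℝ), 0 < δ →
      (∀ a ∈ ω, ∀ b ∈ ω, a ≠ b → δ ≤ dist a b) →
      (∀ x ∈ ω, HasSum (fun y : {y : EuclideanSpace ℝ (Fin 3) // y ∈ ω ∧ y ≠ x} =>
        (deriv Literature.MathematicalPhysics.StatisticalMechanics.lennardJones (dist x y) / dist x y) •
          (x - (y : EuclideanSpace ℝ (Fin 3)))) 0) →
    ∀ a : ℝ, (∀ z : EuclideanSpace ℝ (Fin 3), inner ℝ z γ < a →
        (z ∈ ω ↔ z ∈ (L : Set (EuclideanSpace ℝ (Fin 3))))) →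
      (∀ x ∈ ω, ∃ y ∈ (L : Set (EuclideanSpace ℝ (Fin 3))), ∃ s : ℝ, x = y + s • γ) →
      ω = (L : Set (EuclideanSpace ℝ (Fin 3))) := by
  intro L _ _ γ hγL hγ0 ω δ hδ hsep hbal a hagree hreg
  obtain ⟨δL, -, hδL, -, hsepL, -, -, hbalL⟩ := hbl_lattice_hypotheses L
  have hγn : 0 < ‖γ‖ := norm_pos_iff.2 hγ0
  -- the unit normal `u = γ / ‖γ‖`
  set u : EuclideanSpace ℝ (Fin 3) := ‖γ‖⁻¹ • γ with hu
  have hun : ‖u‖ = 1 := by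
    rw [hu, norm_smul, norm_inv, norm_norm, inv_mul_cancel₀ hγn.ne']
  -- the two sets agree on `{⟪z, u⟫ < a / ‖γ‖}`
  have hagree' : ∀ z : EuclideanSpace ℝ (Fin 3), ⟪z, u⟫_ℝ < a / ‖γ‖ →
      (z ∈ ω ↔ z ∈ (L : Set (EuclideanSpace ℝ (Fin 3)))) := by
    intro z hz
    refine hagree z ?_
    rwa [hu, real_inner_smul_right, inv_mul_eq_div, div_lt_div_iff_of_pos_right hγn] at hz
  -- every point of `ω ∪ L` is registered: `x = y + s γ`, `y ∈ L`
  have hdec : ∀ x ∈ ω ∪ (L : Set (EuclideanSpace ℝ (Fin 3))),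
      ∃ y ∈ (L : Set (EuclideanSpace ℝ (Fin 3))), ∃ s : ℝ, x = y + s • γ := by
    rintro x (hx | hx)
    · exact hreg x hx
    · exact ⟨x, hx, 0, by rw [zero_smul, add_zero]⟩
  refine hbl_eq_of_recurrent_columns ω (L : Set (EuclideanSpace ℝ (Fin 3))) (min δ δL)
    (lt_min hδ hδL)
    (fun p hp q hq hpq => (min_le_left _ _).trans (hsep p hp q hq hpq))
    (fun p hp q hq hpq => (min_le_right _ _).trans (hsepL p hp q hq hpq))
    hbal hbalL u (a / ‖γ‖) hun hagree' fun x hx => ?_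
  -- the column below `x = y + s γ` is recurrent with gaps `‖γ‖`
  obtain ⟨y, hy, s, hxe⟩ := hdec x hx
  refine ⟨(⟪x, γ⟫_ℝ - a) / ‖γ‖ + 1, ‖γ‖, hγn.le, fun T hT => ?_⟩
  obtain ⟨k, hk1, hk2⟩ : ∃ k : ℤ, T / ‖γ‖ - s ≤ k ∧ (k : ℝ) < T / ‖γ‖ - s + 1 :=
    ⟨_, Int.le_ceil _, Int.ceil_lt_add_one _⟩
  have hA : T ≤ ((k : ℝ) + s) * ‖γ‖ := by
    rw [← div_le_iff₀ hγn]
    linarith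
  have hB : ((k : ℝ) + s - 1) * ‖γ‖ < T := by
    rw [← lt_div_iff₀ hγn]
    linarith
  refine ⟨(s + k) * ‖γ‖, by linarith, by linarith, ?_⟩
  -- the point `x - (s + k)‖γ‖ u = y - k γ` of `L`
  have hpt : x - ((s + k) * ‖γ‖) • u = y - (k : ℝ) • γ := by
    rw [hxe, hu, smul_smul, mul_assoc, mul_inv_cancel₀ hγn.ne', mul_one, add_smul]
    abel
  have hL' : y - (k : ℝ) • γ ∈ (L : Set (EuclideanSpace ℝ (Fin 3))) := by
    rw [Int.cast_smul_eq_zsmul ℝ k γ]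
    exact L.sub_mem hy (L.smul_mem k hγL)
  rw [hpt]
  refine (hagree _ ?_).2 hL'
  -- it lies below the plane: `⟪y - k γ, γ⟫ ≤ a - ‖γ‖`
  have hC : ⟪x, γ⟫_ℝ - a ≤ (T - 1) * ‖γ‖ := by
    rw [← div_le_iff₀ hγn]
    linarith
  have hD : T * ‖γ‖ ≤ ((k : ℝ) + s) * ‖γ‖ * ‖γ‖ := mul_le_mul_of_nonneg_right hA hγn.le
  rw [hxe, inner_add_left, real_inner_smul_left, real_inner_self_eq_norm_sq] at hC
  rw [inner_sub_left, real_inner_smul_left, real_inner_self_eq_norm_sq]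
  nlinarith [hC, hD, hγn]

end Summit.AtomisticToContinuum.Crystallization.Theorems.HolmgrenBoyleLind

end
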